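import Literature.Analysis.FluidPDE.HeatKernelFwdSmooth
import Mathlib.Analysis.Calculus.ContDiff.Convolution
import Mathlib.Analysis.Calculus.BumpFunction.FiniteDimension
import HarnessLib

/-!
# Off-diagonal smoothing of forward heat potentials, to all orders, with universal constants

Analysis/FluidPDE support file (everything proved; no definitions, no named facts), written for
the proof of the named fact `Literature.Analysis.FluidPDE.jia_sverak_2014_local_higher_regularity`
(H. Jia, V. Šverák, Invent. Math. 196 (2014) = arXiv:1204.0529, §3 Thm 3.2 and the bootstrap
remark after its proof, p. 9). In the localised Duhamel formula of a solution `u` near a point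
(the tree's `JiaSverak2014.duhamel_representation_datum`), the terms whose data carry
derivatives of the cut-off `φ` — `W₊ ⊛ [(∂ₜφ + Δφ)u]`, `W₊ ⊛ [∂ᵢφ uᵢu]`, `W₊ ⊛ [∂_cφ p]`, and the
multiplier potentials of `∂ᵢφ u` — have data supported in the shell where `∇φ ≠ 0`, at positive
distance `δ` from the inner ball on which `φ ≡ 1`. There the forward heat kernel
`W₊(τ, z) = 1_{τ>0} G_τ(z)` is evaluated only at `‖z‖ ≥ δ`, where it is a `C^∞` function of
`(τ, z)` across `τ = 0` (the tree's `contDiffOn_heatKernelFwd`, `HeatKernelFwdSmooth.lean`;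
Lemarié-Rieusset 2016, §13.9 Step 3), so these terms are smooth on the inner cylinder *whatever
the regularity of `u` and `p`*, with bounds depending only on the `L¹` norm of the data. This
file proves the quantitative all-orders form of this remark:

* `norm_iteratedFDeriv_convolution_le` — for a smooth compactly supported kernel `k` with values
  in a Banach space and `F ∈ L¹`: `‖Dᵐ(F ⋆ k)‖ ≤ (sup ‖Dᵐk‖) ‖F‖₁` (the derivative falls on the
  kernel, Mathlib's `HasCompactSupport.hasFDerivAt_convolution_right`, and `Dk` is a kernel of the
  same kind with values in `G →L W`, so the bound iterates);
* `iteratedFDeriv_slice_eq`, `norm_iteratedFDeriv_slice_le`, `norm_iteratedFDeriv_slice_sub_le` —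
  the `x`-slices of a smooth space–time function: `Dᵐ(Φ(t,·))(x) = DᵐΦ(t,x) ∘ (inr,…,inr)`, hence
  `‖Dᵐ(Φ(t,·))‖ ≤ ‖DᵐΦ‖` and `t ↦ Dᵐ(Φ(t,·))(x)` is Lipschitz with constant `sup ‖Dᵐ⁺¹Φ‖`;
* `exists_truncated_heatKernelFwd` — a kernel `k ∈ C_c^∞(ℝ × E)` equal to `W₊` on
  `{|τ| ≤ 2, δ ≤ ‖z‖ ≤ R}`, with bounds `‖Dᵐk‖ ≤ M m`;
* `exists_offDiagonal_smoothing` — **for `0 < δ ≤ R` there are constants `M m` such that every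
  integrable `F` supported in `[0,1] × E` has a smooth `Φ` with `‖DᵐΦ‖ ≤ M m ‖F‖₁` agreeing with
  `W₊ ⊛ F` at all `(t, x)`, `0 ≤ t ≤ 1`, with `δ ≤ ‖x - y‖ ≤ R` on the support of `F`.**

## References

* P. G. Lemarié-Rieusset, *The Navier–Stokes Problem in the 21st Century* (2016), §13.9 Step 3
  (p. 476). Bib key `LemarieRieusset2016`.
* H. Jia, V. Šverák, Invent. Math. 196 (2014) = arXiv:1204.0529, §3 (p. 9). Bib key
  `JiaSverak2014`.
-/

noncomputable section

open MeasureTheory Set Function Filter Metric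
open _root_.Topology
open scoped ENNReal NNReal Convolution ContDiff

namespace Literature.Analysis.FluidPDE

namespace OffDiagHeat

/-! ## All-order bounds for convolutions with smooth compactly supported kernels -/

section Convolution

variable {G : Type} [NormedAddCommGroup G] [NormedSpace ℝ G] [MeasurableSpace G] [BorelSpace G]
  {μ : Measure G} [SFinite μ] [μ.IsAddLeftInvariant]

omit [MeasurableSpace G] [BorelSpace G] in
/-- `(lsmul).precompR G = lsmul` on operator-valued functions: the shape of the convolution
`F ⋆[lsmul] k` is preserved under differentiation in the kernel. [folklore] -/
theorem lsmul_precompR_eq (W : Type) [NormedAddCommGroup W] [NormedSpace ℝ W] :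
    (ContinuousLinearMap.lsmul ℝ ℝ : ℝ →L[ℝ] W →L[ℝ] W).precompR G =
      (ContinuousLinearMap.lsmul ℝ ℝ : ℝ →L[ℝ] (G →L[ℝ] W) →L[ℝ] (G →L[ℝ] W)) := by
  ext c M
  simp [ContinuousLinearMap.precompR_apply]

/-- The derivative of `F ⋆ k` falls on the smooth compactly supported kernel:
`D(F ⋆ k) = F ⋆ Dk`. [folklore] -/
theorem fderiv_convolution_lsmul_eq {W : Type} [NormedAddCommGroup W] [NormedSpace ℝ W] [CompleteSpace W]
    {k : G → W} (hk : ContDiff ℝ 1 k) (hkc : HasCompactSupport k) {F : G → ℝ}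
    (hF : LocallyIntegrable F μ) :
    fderiv ℝ (F ⋆[ContinuousLinearMap.lsmul ℝ ℝ, μ] k) =
      F ⋆[ContinuousLinearMap.lsmul ℝ ℝ, μ] (fderiv ℝ k) := by
  funext z
  rw [(hkc.hasFDerivAt_convolution_right (L := ContinuousLinearMap.lsmul ℝ ℝ) hF hk z).fderiv,
    lsmul_precompR_eq]

/-- **All-order bounds**: if `‖Dᵐk‖ ≤ B` everywhere for a smooth compactly supported kernel `k`
(values in a Banach space `W`) and `F ∈ L¹`, then `‖Dᵐ(F ⋆ k)(z)‖ ≤ B ‖F‖₁` (induction on `m`,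
the derivative falling on the kernel, whose derivative is a kernel of the same kind with values
in `G →L W`). [folklore] -/
theorem norm_iteratedFDeriv_convolution_le (m : ℕ) :
    ∀ {W : Type} [NormedAddCommGroup W] [NormedSpace ℝ W] [CompleteSpace W] {k : G → W},
      ContDiff ℝ ∞ k → HasCompactSupport k → ∀ {B : ℝ}, (∀ p, ‖iteratedFDeriv ℝ m k p‖ ≤ B) →
      ∀ {F : G → ℝ}, Integrable F μ → ∀ z,
        ‖iteratedFDeriv ℝ m (F ⋆[ContinuousLinearMap.lsmul ℝ ℝ, μ] k) z‖ ≤ B * ∫ w, ‖F w‖ ∂μ := by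
  induction m with
  | zero =>
    intro W _ _ _ k hk hkc B hB F hF z
    rw [norm_iteratedFDeriv_zero, convolution_def]
    have hB' : ∀ p, ‖k p‖ ≤ B := fun p => by simpa using hB p
    have hB0 : 0 ≤ B := (norm_nonneg _).trans (hB' 0)
    calc ‖∫ w, (ContinuousLinearMap.lsmul ℝ ℝ (F w)) (k (z - w)) ∂μ‖ ≤ ∫ w, ‖F w‖ * B ∂μ := by
          refine norm_integral_le_of_norm_le (hF.norm.mul_const B) (Eventually.of_forall fun w => ?_)
          rw [ContinuousLinearMap.lsmul_apply, norm_smul]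
          exact mul_le_mul_of_nonneg_left (hB' _) (norm_nonneg _)
      _ = B * ∫ w, ‖F w‖ ∂μ := by rw [integral_mul_const, mul_comm]
  | succ m ih =>
    intro W _ _ _ k hk hkc B hB F hF z
    rw [← norm_iteratedFDeriv_fderiv, fderiv_convolution_lsmul_eq (hk.of_le (by exact_mod_cast le_top)) hkc
      hF.locallyIntegrable]
    have hk' : ContDiff ℝ ∞ (fderiv ℝ k) := hk.fderiv_right (by exact_mod_cast le_top)
    have hB' : ∀ p, ‖iteratedFDeriv ℝ m (fderiv ℝ k) p‖ ≤ B := fun p => by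
      rw [norm_iteratedFDeriv_fderiv]; exact hB p
    exact ih hk' (hkc.fderiv ℝ) hB' hF z

omit [SFinite μ] [μ.IsAddLeftInvariant] in
/-- `F ⋆ k` is smooth for a smooth compactly supported kernel and locally integrable `F`. [folklore] -/
theorem contDiff_convolution_lsmul {W : Type} [NormedAddCommGroup W] [NormedSpace ℝ W] [CompleteSpace W]
    {k : G → W} (hk : ContDiff ℝ ∞ k) (hkc : HasCompactSupport k) {F : G → ℝ}
    (hF : LocallyIntegrable F μ) :
    ContDiff ℝ ∞ (F ⋆[ContinuousLinearMap.lsmul ℝ ℝ, μ] k) :=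
  hkc.contDiff_convolution_right _ hF hk

end Convolution

/-! ## Slices of smooth space–time functions -/

section Slices

variable {E : Type} [NormedAddCommGroup E] [NormedSpace ℝ E]
variable {W : Type} [NormedAddCommGroup W] [NormedSpace ℝ W]

/-- The `x`-slice of a smooth function of `(t, x)` is smooth. [folklore] -/
theorem contDiff_slice {Φ : ℝ × E → W} {n : ℕ∞} (hΦ : ContDiff ℝ n Φ) (t : ℝ) :
    ContDiff ℝ n fun x => Φ (t, x) :=
  hΦ.comp (contDiff_const.prodMk contDiff_id)

/-- The iterated `x`-derivatives of a slice are the restrictions of the full iterated derivatives: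
`Dᵐ(Φ(t, ·))(x) = DᵐΦ(t, x) ∘ (inr, …, inr)`. [folklore] -/
theorem iteratedFDeriv_slice_eq {Φ : ℝ × E → W} (hΦ : ContDiff ℝ ∞ Φ) (t : ℝ) (m : ℕ) (x : E) :
    iteratedFDeriv ℝ m (fun x => Φ (t, x)) x =
      (iteratedFDeriv ℝ m Φ (t, x)).compContinuousLinearMap fun _ => ContinuousLinearMap.inr ℝ ℝ E := by
  have h1 : (fun x => Φ (t, x)) = (fun p : ℝ × E => Φ (((t, 0) : ℝ × E) + p)) ∘ (ContinuousLinearMap.inr ℝ ℝ E) := by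
    funext x; simp
  have hΦ' : ContDiff ℝ ∞ (fun p : ℝ × E => Φ (((t, 0) : ℝ × E) + p)) := hΦ.comp (contDiff_const.add contDiff_id)
  rw [h1, ContinuousLinearMap.iteratedFDeriv_comp_right (ContinuousLinearMap.inr ℝ ℝ E)
    (f := fun p : ℝ × E => Φ (((t, 0) : ℝ × E) + p)) hΦ' x (by exact_mod_cast le_top)]
  congr 1
  rw [iteratedFDeriv_comp_add_left]
  simp

/-- `‖inr‖ ≤ 1`. [folklore] -/
theorem norm_inr_le_one : ‖ContinuousLinearMap.inr ℝ ℝ E‖ ≤ 1 :=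
  ContinuousLinearMap.opNorm_le_bound _ zero_le_one fun x => by simp

/-- **Slice derivatives are bounded by full derivatives**: `‖Dᵐ(Φ(t, ·))(x)‖ ≤ ‖DᵐΦ(t, x)‖`. [folklore] -/
theorem norm_iteratedFDeriv_slice_le {Φ : ℝ × E → W} (hΦ : ContDiff ℝ ∞ Φ) (t : ℝ) (m : ℕ) (x : E) :
    ‖iteratedFDeriv ℝ m (fun x => Φ (t, x)) x‖ ≤ ‖iteratedFDeriv ℝ m Φ (t, x)‖ := by
  rw [iteratedFDeriv_slice_eq hΦ t m x]
  refine (ContinuousMultilinearMap.norm_compContinuousLinearMap_le _ _).trans ?_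
  have hprod : ∏ _i : Fin m, ‖ContinuousLinearMap.inr ℝ ℝ E‖ ≤ 1 :=
    Finset.prod_le_one (fun _ _ => norm_nonneg _) fun _ _ => norm_inr_le_one
  calc ‖iteratedFDeriv ℝ m Φ (t, x)‖ * ∏ _i : Fin m, ‖ContinuousLinearMap.inr ℝ ℝ E‖
      ≤ ‖iteratedFDeriv ℝ m Φ (t, x)‖ * 1 := mul_le_mul_of_nonneg_left hprod (norm_nonneg _)
    _ = _ := mul_one _

/-- **Time-Lipschitz bound for slice derivatives**: if `‖Dᵐ⁺¹Φ‖ ≤ B` everywhere, then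
`‖Dᵐ(Φ(t,·))(x) - Dᵐ(Φ(t',·))(x)‖ ≤ B |t - t'|`. [folklore] -/
theorem norm_iteratedFDeriv_slice_sub_le {Φ : ℝ × E → W} (hΦ : ContDiff ℝ ∞ Φ) {m : ℕ} {B : ℝ}
    (hB : ∀ p, ‖iteratedFDeriv ℝ (m + 1) Φ p‖ ≤ B) (t t' : ℝ) (x : E) :
    ‖iteratedFDeriv ℝ m (fun x => Φ (t, x)) x - iteratedFDeriv ℝ m (fun x => Φ (t', x)) x‖ ≤ B * |t - t'| := by
  rw [iteratedFDeriv_slice_eq hΦ t m x, iteratedFDeriv_slice_eq hΦ t' m x]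
  set M := iteratedFDeriv ℝ m Φ (t, x) with hM
  set M' := iteratedFDeriv ℝ m Φ (t', x) with hM'
  have hsub : (M.compContinuousLinearMap fun _ => ContinuousLinearMap.inr ℝ ℝ E) -
      (M'.compContinuousLinearMap fun _ => ContinuousLinearMap.inr ℝ ℝ E) =
      (M - M').compContinuousLinearMap fun _ => ContinuousLinearMap.inr ℝ ℝ E := by
    ext v; simp
  rw [hsub]
  have hprod : ∏ _i : Fin m, ‖ContinuousLinearMap.inr ℝ ℝ E‖ ≤ 1 :=
    Finset.prod_le_one (fun _ _ => norm_nonneg _) fun _ _ => norm_inr_le_one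
  -- mean value for `DᵐΦ` along the segment from `(t', x)` to `(t, x)`
  have hB0 : 0 ≤ B := (norm_nonneg _).trans (hB (t, x))
  have hd : Differentiable ℝ (iteratedFDeriv ℝ m Φ) :=
    hΦ.differentiable_iteratedFDeriv (m := m) (by exact_mod_cast ENat.coe_lt_top m)
  have hmv : ‖M - M'‖ ≤ B * |t - t'| := by
    have h := Convex.norm_image_sub_le_of_norm_fderiv_le (f := iteratedFDeriv ℝ m Φ) (fun p _ => hd p)
      (fun p _ => by rw [norm_fderiv_iteratedFDeriv]; exact hB p) convex_univ (mem_univ ((t', x) : ℝ × E))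
      (mem_univ ((t, x) : ℝ × E))
    rw [hM, hM']
    refine h.trans (le_of_eq ?_)
    rw [Prod.mk_sub_mk, sub_self, Prod.norm_mk, norm_zero, max_eq_left (norm_nonneg _), Real.norm_eq_abs]
  calc ‖(M - M').compContinuousLinearMap fun _ => ContinuousLinearMap.inr ℝ ℝ E‖
      ≤ ‖M - M'‖ * ∏ _i : Fin m, ‖ContinuousLinearMap.inr ℝ ℝ E‖ :=
        ContinuousMultilinearMap.norm_compContinuousLinearMap_le _ _
    _ ≤ ‖M - M'‖ * 1 := mul_le_mul_of_nonneg_left hprod (norm_nonneg _)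
    _ ≤ B * |t - t'| := by rw [mul_one]; exact hmv

end Slices

/-! ## The truncated forward heat kernel and off-diagonal smoothing of heat potentials -/

section Kernel

variable {E : Type} [NormedAddCommGroup E] [InnerProductSpace ℝ E] [FiniteDimensional ℝ E]

/-- **A smooth compactly supported kernel agreeing with the forward heat kernel off the
diagonal.** For `0 < δ ≤ R` there is `k ∈ C_c^∞(ℝ × E)` with `k(τ, z) = W₊(τ, z)` whenever
`|τ| ≤ 2` and `δ ≤ ‖z‖ ≤ R` (a cut-off of the zero-extended heat kernel, which is smooth across
`τ = 0` away from `z = 0`, `contDiffOn_heatKernelFwd`), together with bounds `‖Dᵐk‖ ≤ M m` for all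
`m`. [folklore] -/
theorem exists_truncated_heatKernelFwd {δ R : ℝ} (hδ : 0 < δ) (hδR : δ ≤ R) :
    ∃ k : ℝ × E → ℝ, ContDiff ℝ ∞ k ∧ HasCompactSupport k ∧
      (∀ p : ℝ × E, |p.1| ≤ 2 → δ ≤ ‖p.2‖ → ‖p.2‖ ≤ R → k p = heatKernelFwd 1 p) ∧
      ∃ M : ℕ → ℝ, ∀ m p, ‖iteratedFDeriv ℝ m k p‖ ≤ M m := by
  -- the three bumps
  let ϑ₁ : ContDiffBump (0 : ℝ) := ⟨2, 3, by norm_num, by norm_num⟩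
  let b : ContDiffBump (0 : E) := ⟨δ / 2, δ, by positivity, by linarith⟩
  let Bmp : ContDiffBump (0 : E) := ⟨R, R + 1, by linarith, by linarith⟩
  set k : ℝ × E → ℝ := fun p => ϑ₁ p.1 * ((1 - b p.2) * Bmp p.2) * heatKernelFwd 1 p with hk
  have hsm1 : ContDiff ℝ ∞ fun p : ℝ × E => ϑ₁ p.1 * ((1 - b p.2) * Bmp p.2) :=
    (ϑ₁.contDiff.comp contDiff_fst).mul
      (((contDiff_const.sub (b.contDiff.comp contDiff_snd))).mul (Bmp.contDiff.comp contDiff_snd))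
  -- smoothness: on `‖z‖ > 0` a product of smooth functions, near `z = 0` identically zero
  have hO : IsOpen {p : ℝ × E | (0 : ℝ) < ‖p.2‖} := isOpen_setOf_lt_norm_snd 0
  have hO' : IsOpen {p : ℝ × E | ‖p.2‖ < δ / 2} := isOpen_lt (continuous_norm.comp continuous_snd) continuous_const
  have hkO : ContDiffOn ℝ ∞ k {p : ℝ × E | (0 : ℝ) < ‖p.2‖} :=
    hsm1.contDiffOn.mul (contDiffOn_heatKernelFwd_of_norm one_pos le_rfl)
  have hkO' : ∀ p : ℝ × E, ‖p.2‖ < δ / 2 → k p = 0 := fun p hp => by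
    have hb1 : b p.2 = 1 := b.one_of_mem_closedBall (by simpa [mem_closedBall, dist_zero_right] using hp.le)
    simp [hk, hb1]
  have hkc : ContDiff ℝ ∞ k := by
    rw [contDiff_iff_contDiffAt]
    intro p
    by_cases hp : (0 : ℝ) < ‖p.2‖
    · exact hkO.contDiffAt (hO.mem_nhds hp)
    · have hp0 : ‖p.2‖ < δ / 2 := by push Not at hp; linarith [norm_nonneg p.2]
      have hev : k =ᶠ[𝓝 p] fun _ => 0 :=
        Filter.eventually_of_mem (hO'.mem_nhds hp0) fun q hq => hkO' q hq
      exact (contDiffAt_const (c := (0 : ℝ))).congr_of_eventuallyEq hev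
  -- compact support
  have hsupp : ∀ p : ℝ × E, p ∉ closedBall (0 : ℝ) 3 ×ˢ closedBall (0 : E) (R + 1) → k p = 0 := by
    intro p hp
    rw [mem_prod, not_and_or] at hp
    rcases hp with h1 | h2
    · have : ϑ₁ p.1 = 0 := ϑ₁.zero_of_le_dist (by
        rw [mem_closedBall, dist_zero_right, Real.norm_eq_abs, not_le] at h1
        rw [dist_zero_right, Real.norm_eq_abs]; exact h1.le)
      simp [hk, this]
    · have : Bmp p.2 = 0 := Bmp.zero_of_le_dist (by
        rw [mem_closedBall, dist_zero_right, not_le] at h2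
        rw [dist_zero_right]; exact h2.le)
      simp [hk, this]
  have hkcs : HasCompactSupport k :=
    HasCompactSupport.intro ((isCompact_closedBall _ _).prod (isCompact_closedBall _ _)) hsupp
  -- agreement off the diagonal
  have hagree : ∀ p : ℝ × E, |p.1| ≤ 2 → δ ≤ ‖p.2‖ → ‖p.2‖ ≤ R → k p = heatKernelFwd 1 p := by
    intro p h1 h2 h3
    have e1 : ϑ₁ p.1 = 1 := ϑ₁.one_of_mem_closedBall (by
      rw [mem_closedBall, dist_zero_right, Real.norm_eq_abs]; exact h1)
    have e2 : b p.2 = 0 := b.zero_of_le_dist (by rw [dist_zero_right]; exact h2)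
    have e3 : Bmp p.2 = 1 := Bmp.one_of_mem_closedBall (by rw [mem_closedBall, dist_zero_right]; exact h3)
    simp [hk, e1, e2, e3]
  -- bounds
  have hM : ∀ m, ∃ Mm : ℝ, ∀ p, ‖iteratedFDeriv ℝ m k p‖ ≤ Mm := fun m =>
    (hkcs.iteratedFDeriv (𝕜 := ℝ) m).exists_bound_of_continuous (hkc.continuous_iteratedFDeriv (by exact_mod_cast le_top))
  choose M hM using hM
  exact ⟨k, hkc, hkcs, hagree, M, hM⟩

/-- **Off-diagonal agreement of the heat potential with a smooth convolution.** With `k` as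
above and real data `F` supported in `{(s, y) : 0 ≤ s ≤ 1}`: at every `(t, x)` with `0 ≤ t ≤ 1`
such that `δ ≤ ‖x - y‖ ≤ R` on the support of `F`, `W₊ ⊛ F (t, x) = (F ⋆ k)(t, x)`. [folklore] -/
theorem heatPotential_eq_convolution_of_separated [MeasurableSpace E] [BorelSpace E] {k : ℝ × E → ℝ} {δ R : ℝ}
    (hk : ∀ p : ℝ × E, |p.1| ≤ 2 → δ ≤ ‖p.2‖ → ‖p.2‖ ≤ R → k p = heatKernelFwd 1 p)
    {F : ℝ × E → ℝ} (hF : ∀ w, F w ≠ 0 → w.1 ∈ Icc (0 : ℝ) 1) {t : ℝ} (ht : t ∈ Icc (0 : ℝ) 1)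
    {x : E} (hsep : ∀ w, F w ≠ 0 → δ ≤ ‖x - w.2‖ ∧ ‖x - w.2‖ ≤ R) :
    heatPotential 1 F (t, x) = (F ⋆[ContinuousLinearMap.lsmul ℝ ℝ, volume] k) (t, x) := by
  rw [heatPotential, convolution_def]
  refine integral_congr_ae (Eventually.of_forall fun w => ?_)
  simp only [ContinuousLinearMap.lsmul_apply, smul_eq_mul]
  by_cases hw : F w = 0
  · simp [hw]
  · rw [mul_comm, hk ((t, x) - w)]
    · have h1 := hF w hw
      simp only [Prod.fst_sub, mem_Icc] at h1 ht ⊢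
      rw [abs_le]; constructor <;> linarith [h1.1, h1.2, ht.1, ht.2]
    · exact (hsep w hw).1
    · exact (hsep w hw).2

/-- **Off-diagonal smoothing of forward heat potentials, all orders, universal constants.** For
`0 < δ ≤ R` there are constants `M m` (`m ∈ ℕ`) such that for every integrable real `F` on
`ℝ × E` supported in `[0, 1] × E` there is a smooth `Φ : ℝ × E → ℝ` with `‖DᵐΦ‖ ≤ M m ‖F‖₁`
everywhere, which coincides with the heat potential `W₊ ⊛ F` at every `(t, x)`, `0 ≤ t ≤ 1`,
separated from the data: `δ ≤ ‖x - y‖ ≤ R` for all `(s, y)` in the support of `F`. In particular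
the `x`-slices of `W₊ ⊛ F` are smooth there with `‖Dᵐ_x‖ ≤ M m ‖F‖₁` and are `M (m+1) ‖F‖₁`-Lipschitz
in `t` (`norm_iteratedFDeriv_slice_le`, `norm_iteratedFDeriv_slice_sub_le`). This is the
smoothing of the terms of a localised Duhamel formula whose data carry derivatives of the
cut-off (Lemarié-Rieusset 2016, §13.9 Step 3), in quantitative form. [cite: LemarieRieusset2016, §13.9 Step 3 p. 476] -/
theorem exists_offDiagonal_smoothing [MeasurableSpace E] [BorelSpace E] {δ R : ℝ} (hδ : 0 < δ) (hδR : δ ≤ R) :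
    ∃ M : ℕ → ℝ, ∀ (F : ℝ × E → ℝ), Integrable F volume → (∀ w, F w ≠ 0 → w.1 ∈ Icc (0 : ℝ) 1) →
      ∃ Φ : ℝ × E → ℝ, ContDiff ℝ ∞ Φ ∧
        (∀ m z, ‖iteratedFDeriv ℝ m Φ z‖ ≤ M m * ∫ w, ‖F w‖) ∧
        ∀ (t : ℝ) (x : E), t ∈ Icc (0 : ℝ) 1 → (∀ w, F w ≠ 0 → δ ≤ ‖x - w.2‖ ∧ ‖x - w.2‖ ≤ R) →
          heatPotential 1 F (t, x) = Φ (t, x) := by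
  haveI : (volume : Measure (ℝ × E)).IsAddLeftInvariant := Measure.prod.instIsAddLeftInvariant
  obtain ⟨k, hk, hkc, hagree, M, hM⟩ := exists_truncated_heatKernelFwd (E := E) hδ hδR
  refine ⟨M, fun F hF hFt => ⟨F ⋆[ContinuousLinearMap.lsmul ℝ ℝ, volume] k,
    contDiff_convolution_lsmul hk hkc hF.locallyIntegrable, fun m z => ?_, fun t x ht hsep => ?_⟩⟩
  · exact norm_iteratedFDeriv_convolution_le m hk hkc (hM m) hF z
  · exact heatPotential_eq_convolution_of_separated hagree hFt ht hsep

end Kernel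

end OffDiagHeat

end Literature.Analysis.FluidPDE
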